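import Summits.HodgeConjecture.CorCM.Census.TwentyFourDicyclicRelations

/-!
# Degree-24 atlas, type `Dic₆` (sequel): the minimality **`μ(Dic₆) ≥ 172`** — two invariants BEYOND the block parities (kernel census)

COR-CM (cell `pub-hodgecm2`), count-neutral kernel census by the literature seat lit-andre-3 (gen 17; claim TWENTYFOUR-DICYCLIC), sequel of
`Census/TwentyFourDicyclicRelations.lean` (same conventions, dictionary and citations).  THE NEW PHENOMENON OF THIS ROW.  On every earlier
page of the atlas (`Census/*Minimality.lean`, degrees `6–20`, and `ℤ/24`) the minimal number `μ` of Galois orbits of integer Hodge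
vectors generating the Hodge lattice `H` of the slice modulo the divisor classes `P` equals the BLOCK-PARITY FLOOR: the parities
`v ↦ Σ_{x ∈ block b} v(x) mod 2` are translation invariant, vanish on `P`, and satisfy `1 + δ` relations on `H` (b09's
`Census/BlockParityLaw.lean` … `CorCM/FaceParityFloor.lean`: `μ ≥ β − 1 − δ`).  For `Dic₆`: `β = 172` blocks, TWO relations — the blocks
split `86 + 86` into the classes `A ∋ S₀` and `B ∋ S₁` and `Σ_{b ∈ A} parity_b ≡ Σ_{b ∈ B} parity_b ≡ 0` on `H` (`inRelA`,
`inRelA_spec`, `rel_hodge` of `Census/TwentyFourDicyclicRelations.lean`) — so the parities give only `170`.  But `μ(Dic₆) = 172`: the two missing `G`-invariant functionals on `H/P ⊗ 𝔽₂` are the HALF-PARITIES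
`ψ_A(v) = Σ v(x)` over the labels `x` of the `A`-blocks whose embedding lies in the cyclic index-two subgroup `⟨a⟩ ◁ G` (for a fourfold
label: in the image `⟨ā⟩ ⊂ Q₈`), and `ψ_B` likewise (`cosetA`, `colPred`).  They vanish on `P` (`c = a⁶ ∈ ⟨a⟩`), are invariant under
left multiplication by `a` on ALL vectors, and under `x` they change by the relation: `ψ_R(x·v) = Σ_{b ∈ R} parity_b(v) − ψ_R(v) ≡ ψ_R(v)`
ON THE HODGE LATTICE ONLY (`coordFun_transl_hodge`) — transgression classes of `H¹(G, (H/P ⊗ 𝔽₂)^⊥)`, not restrictions of invariant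
ambient functionals.  With the `170` parities (blocks `2 ∈ A` and `3 ∈ B` dropped) they form `coordFun : ℤ^{4096} → 𝔽₂^{172}`,
additive, killing `P`, translation invariant on `H`, and ONTO from `H`: the six internal faces give the six step-`0` coordinates
(parities of `X ∖ {2, 3}` and `ψ_A, ψ_B`; an explicit `6 × 6` inverse, `rows_base`) and the growth faces are triangular in the remaining
parities (`rows_triangular`, induction on the step `unit_mem_rowSpan`).  Hence **`le_card_of_generates_172`**: every finite family
`S ⊆ H` with `H ≤ P + Σ_{t ∈ S} ℤ[G]·t` has `|S| ≥ 172` (`= #blocks = dim_{𝔽₂}(H/P ⊗ 𝔽₂)_G`; the upper bound, attained by the `172`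
faces, is `Census/TwentyFourDicyclicLattice.lean`).  Oracle cross-checks (`scratch/dic6faces.py`): `dim (H/P ⊗ 𝔽₂)_G = 172`, the
`G`-invariant functionals form a space of dimension `184 = 172 + 12` of which block indicators and `(H/P ⊗ 𝔽₂)^⊥` span `182`, and
`ψ_A, ψ_B` complete a basis.  No named fact, no `sorry`.  HC_CM is not proved anywhere in this cell; nothing here is a headline.

## References
* [Pohlmann1968] H. Pohlmann, Algebraic cycles on abelian varieties of complex multiplication type, Ann. of Math. 88 (1968), Thm 1.
* [Milne1999] J. S. Milne, Lefschetz motives and the Tate conjecture, Compositio Math. 117 (1999), Prop. 2.1, p. 54.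
-/

namespace Summit.HodgeConjecture.CorCM.Census.TwentyFourDicyclicSpecies

open Finset QuaternionGroup

/-! ## The `172` coordinates: `170` block parities and the two half-parities -/

set_option maxRecDepth 100000 in
/-- The blocks of the `170` parity coordinates: all blocks except `2` (dropped from class `A`) and `3` (dropped from class `B`). [folklore] -/
def colBlock : Fin 170 → ℕ :=
  ![0, 1, 4, 5, 6, 7, 8, 9, 10, 11, 12, 13, 14, 15, 16, 17, 18, 19, 20, 21, 22, 23, 24, 25, 26, 27, 28, 29, 30, 31, 32, 33, 34, 35, 36, 37, 38, 39, 40, 41, 42, 43, 44, 45,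
    46, 47, 48, 49, 50, 51, 52, 53, 54, 55, 56, 57, 58, 59, 60, 61, 62, 63, 64, 65, 66, 67, 68, 69, 70, 71, 72, 73, 74, 75, 76, 77, 78, 79, 80, 81, 82, 83, 84, 85, 86, 87, 88, 89,
    90, 91, 92, 93, 94, 95, 96, 97, 98, 99, 100, 101, 102, 103, 104, 105, 106, 107, 108, 109, 110, 111, 112, 113, 114, 115, 116, 117, 118, 119, 120, 121, 122, 123, 124, 125, 126, 127, 128, 129, 130, 131, 132, 133,
    134, 135, 136, 137, 138, 139, 140, 141, 142, 143, 144, 145, 146, 147, 148, 149, 150, 151, 152, 153, 154, 155, 156, 157, 158, 159, 160, 161, 162, 163, 164, 165, 166, 167, 168, 169, 170, 171]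

/-- The predicate of coordinate `j`: `j < 170` — the label lies in block `colBlock j`; `j = 170` (`ψ_A`) — an `A`-block label with
embedding in `⟨a⟩`; `j = 171` (`ψ_B`) — a `B`-block label with embedding in `⟨a⟩`. [folklore] -/
def colPred (j : Fin 172) (x : Pt) : Bool :=
  if h : j.val < 170 then decide (blockOf x = colBlock ⟨j.val, h⟩) else (inRelA (blockOf x) == decide (j.val = 170)) && cosetA x

/-- The coordinate map `ℤ^{4096} → 𝔽₂^{172}` (unbundled). [folklore] -/
def coordFun (m : Pt → ℤ) (j : Fin 172) : ZMod 2 := ∑ x : Pt, if colPred j x then ((m x : ℤ) : ZMod 2) else 0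

/-- Additivity. [folklore] -/
theorem coordFun_add (m m' : Pt → ℤ) : coordFun (m + m') = coordFun m + coordFun m' := by
  funext j
  rw [Pi.add_apply, coordFun, coordFun, coordFun, ← Finset.sum_add_distrib]
  refine Finset.sum_congr rfl fun x _ => ?_
  rw [Pi.add_apply, Int.cast_add]
  split_ifs <;> simp

/-- Homogeneity. [folklore] -/
theorem coordFun_smul (c : ℤ) (m : Pt → ℤ) : coordFun (c • m) = c • coordFun m := by
  funext j
  rw [Pi.smul_apply, coordFun, coordFun, Finset.smul_sum]
  refine Finset.sum_congr rfl fun x _ => ?_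
  rw [Pi.smul_apply]
  split_ifs <;> simp [zsmul_eq_mul]

/-- `coordFun 0 = 0`. [folklore] -/
theorem coordFun_zero : coordFun 0 = 0 := by
  funext j
  rw [coordFun, Pi.zero_apply]
  refine Finset.sum_eq_zero fun x _ => ?_
  rw [Pi.zero_apply, Int.cast_zero, ite_self]

/-- The coordinates of a square-free monomial count its labels. [folklore] -/
theorem coordFun_ind (S : Finset Pt) (j : Fin 172) : coordFun (ind S) j = ((S.filter fun x => colPred j x).card : ZMod 2) := by
  rw [coordFun, Finset.card_filter, Nat.cast_sum]
  have e : ∀ x : Pt, (if colPred j x then (((ind S x : ℤ)) : ZMod 2) else 0) =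
      if x ∈ S then (if colPred j x then (1 : ZMod 2) else 0) else 0 := by
    intro x
    unfold ind
    split_ifs <;> simp
  simp_rw [e]
  rw [Finset.sum_ite_mem, Finset.univ_inter]
  refine Finset.sum_congr rfl fun x _ => ?_
  split_ifs <;> simp

/-- The coordinate predicates are conjugation invariant (`c = a⁶` fixes blocks and lies in `⟨a⟩`). [folklore] -/
theorem colPred_conj (j : Fin 172) (x : Pt) : colPred j (act (a 6) x) = colPred j x := by
  unfold colPred
  rw [blockOf_act, cosetA_facts.1]

/-- The coordinates vanish on every conjugate pair. [folklore] -/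
theorem coordFun_pairVec (x : Pt) : coordFun (pairVec x) = 0 := by
  funext j
  rw [pairVec, coordFun_ind, Pi.zero_apply]
  by_cases hb : colPred j x = true
  · have hset : ({x, act (a 6) x} : Finset Pt).filter (fun y => colPred j y) = {x, act (a 6) x} := by
      refine Finset.filter_true_of_mem fun y hy => ?_
      rw [Finset.mem_insert, Finset.mem_singleton] at hy
      rcases hy with rfl | rfl
      · exact hb
      · rw [colPred_conj]; exact hb
    rw [hset, Finset.card_pair (conj_ne x).symm]
    decide
  · have h0 : (({x, act (a 6) x} : Finset Pt).filter (fun y => colPred j y)).card = 0 := by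
      refine Finset.card_eq_zero.mpr (Finset.filter_eq_empty_iff.mpr ?_)
      intro y hy hby
      rw [Finset.mem_insert, Finset.mem_singleton] at hy
      rcases hy with rfl | rfl
      · exact hb hby
      · exact hb (by rw [colPred_conj] at hby; exact hby)
    rw [h0, Nat.cast_zero]

/-- Translation reindexes the coordinate sums. [folklore] -/
theorem coordFun_transl (g : G) (v : Pt → ℤ) (j : Fin 172) :
    coordFun (transl g v) j = ∑ x : Pt, if colPred j (act g x) then ((v x : ℤ) : ZMod 2) else 0 := by
  rw [coordFun, ← Equiv.sum_comp (actEquiv g) (fun x => if colPred j x then ((transl g v x : ℤ) : ZMod 2) else 0)]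
  refine Finset.sum_congr rfl fun x _ => ?_
  show (if colPred j (act g x) then (((v (act g⁻¹ (act g x))) : ℤ) : ZMod 2) else 0) = _
  rw [← act_mul, inv_mul_cancel, act_one]

/-- Invariance under `a` (on all vectors): `a` fixes blocks and `⟨a⟩`-cosets. [folklore] -/
theorem coordFun_transl_a1 (v : Pt → ℤ) (j : Fin 172) : coordFun (transl (a 1) v) j = coordFun v j := by
  rw [coordFun_transl, coordFun]
  refine Finset.sum_congr rfl fun x _ => ?_
  have e : colPred j (act (a 1) x) = colPred j x := by
    unfold colPred
    rw [blockOf_act, cosetA_facts.2.1]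
  rw [e]

/-- **Invariance under `x` holds on the Hodge lattice** (for the parities trivially; for `ψ_R` because `x` swaps the two `⟨a⟩`-cosets
and the full block sum over the class `R` vanishes on `H`). [folklore] -/
theorem coordFun_transl_x0 {v : Pt → ℤ} (hv : v ∈ hodgeLattice) (j : Fin 172) : coordFun (transl (xa 0) v) j = coordFun v j := by
  rw [coordFun_transl, coordFun]
  by_cases hj : j.val < 170
  · refine Finset.sum_congr rfl fun x _ => ?_
    have e : colPred j (act (xa 0) x) = colPred j x := by
      unfold colPred
      rw [dif_pos hj, dif_pos hj, blockOf_act]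
    rw [e]
  · have e1 : ∀ x : Pt, colPred j (act (xa 0) x) = ((inRelA (blockOf x) == decide (j.val = 170)) && !cosetA x) := by
      intro x
      unfold colPred
      rw [dif_neg hj, blockOf_act, cosetA_facts.2.2]
    have e2 : ∀ x : Pt, colPred j x = ((inRelA (blockOf x) == decide (j.val = 170)) && cosetA x) := by
      intro x
      unfold colPred
      rw [dif_neg hj]
    simp_rw [e1, e2]
    have e3 : ∀ x : Pt, (if ((inRelA (blockOf x) == decide (j.val = 170)) && !cosetA x) then ((v x : ℤ) : ZMod 2) else 0) =
        (if (inRelA (blockOf x) == decide (j.val = 170)) then ((v x : ℤ) : ZMod 2) else 0) -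
          (if ((inRelA (blockOf x) == decide (j.val = 170)) && cosetA x) then ((v x : ℤ) : ZMod 2) else 0) := by
      intro x
      cases (inRelA (blockOf x) == decide (j.val = 170)) <;> cases cosetA x <;> simp
    simp_rw [e3]
    rw [Finset.sum_sub_distrib, rel_hodge _ hv, zero_sub, ZMod.neg_eq_self_mod_two]

/-- **The coordinates are translation invariant on the Hodge lattice** (every `g` is a word in `a`, `x`). [folklore] -/
theorem coordFun_transl_hodge (g : G) {v : Pt → ℤ} (hv : v ∈ hodgeLattice) (j : Fin 172) : coordFun (transl g v) j = coordFun v j := by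
  have hpow : ∀ n : ℕ, ∀ w : Pt → ℤ, w ∈ hodgeLattice → coordFun (transl ((a 1 : G) ^ n) w) j = coordFun w j := by
    intro n
    induction n with
    | zero => intro w _; rw [pow_zero, transl_one]
    | succ n ih =>
      intro w hw
      rw [pow_succ, transl_mul, ih _ (hodge_transl _ hw), coordFun_transl_a1]
  have ha : ∀ i : ZMod (2 * 6), ∀ w : Pt → ℤ, w ∈ hodgeLattice → coordFun (transl (a i) w) j = coordFun w j := by
    intro i w hw
    have e : (a i : G) = (a 1 : G) ^ i.val := by rw [a_one_pow, ZMod.natCast_zmod_val]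
    rw [e]
    exact hpow _ w hw
  rcases g with i | i
  · exact ha i v hv
  · have e : (xa i : G) = xa 0 * a i := by rw [xa_mul_a, zero_add]
    rw [e, transl_mul, coordFun_transl_x0 (hodge_transl _ hv), ha i v hv]

/-- **The half-parities are NOT translation invariant off the Hodge lattice** (they are transgressions, not restrictions of invariant
ambient functionals): `x` moves the coordinate vector of the label `q 0 (a 0)` (block `B₀ = 2 ∈ A`, embedding `1 ∈ ⟨a⟩`) to that of
`q 0 (xa 0)` (embedding `x ∉ ⟨a⟩`), changing `ψ_A` from `1` to `0`. [folklore] -/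
theorem halfParity_not_invariant :
    coordFun (transl (xa 0) (ind {q 0 (a 0)})) ⟨170, by omega⟩ ≠ coordFun (ind {q 0 (a 0)}) ⟨170, by omega⟩ := by
  have e : transl (xa 0) (ind ({q 0 (a 0)} : Finset Pt)) = ind {q 0 (xa 0)} := by
    funext y
    show (if act (xa 0)⁻¹ y ∈ ({q 0 (a 0)} : Finset Pt) then (1 : ℤ) else 0) = if y ∈ ({q 0 (xa 0)} : Finset Pt) then 1 else 0
    simp only [Finset.mem_singleton]
    have key : act (xa 0)⁻¹ y = q 0 (a 0) ↔ y = q 0 (xa 0) := by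
      constructor
      · intro h
        have h2 := congrArg (act (xa 0)) h
        rw [← act_mul, mul_inv_cancel, act_one] at h2
        rw [h2]; decide
      · rintro rfl; decide
    simp only [key]
  rw [e, coordFun_ind, coordFun_ind]
  decide

/-! ## The coordinate rows of the faces span `𝔽₂^{172}` -/

/-- The coordinate row of face `k`. [folklore] -/
def rowOf (k : Fin 172) (j : Fin 172) : ZMod 2 := (((orbitRep k).filter fun x => colPred j x).card : ZMod 2)

/-- The rows are the coordinates of the faces. [folklore] -/
theorem coordFun_atomVec (k : Fin 172) : coordFun (atomVec k) = rowOf k := by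
  funext j
  rw [atomVec, coordFun_ind, rowOf]

/-- The step of a coordinate: the step of its block for a parity, `0` for `ψ_A, ψ_B`. [folklore] -/
def colStep (j : Fin 172) : ℕ := if h : j.val < 170 then rank.getD (colBlock ⟨j.val, h⟩) 0 else 0

set_option maxRecDepth 100000 in
/-- The parity coordinate of the block introduced by growth face `k` (junk `0` for the internal faces). [folklore] -/
def colOfFace : Fin 172 → ℕ :=
  ![0, 0, 0, 0, 0, 0, 43, 74, 89, 28, 80, 6, 90, 9, 7, 143, 37, 136, 24, 144, 60, 115, 15, 4, 12, 13, 14, 69, 51, 50, 47, 55, 105, 59, 29, 18, 63, 120, 150, 66, 3, 102, 101, 122,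
    107, 110, 46, 95, 82, 68, 16, 135, 152, 17, 38, 39, 127, 35, 119, 53, 73, 99, 52, 91, 48, 25, 19, 112, 111, 49, 57, 33, 77, 56, 54, 22, 10, 8, 75, 79, 85, 45, 81, 67, 134, 160, 106, 97,
    87, 21, 71, 108, 72, 118, 44, 113, 151, 140, 145, 164, 156, 167, 138, 125, 70, 103, 155, 162, 169, 165, 41, 157, 96, 132, 64, 137, 93, 31, 27, 94, 98, 32, 161, 159, 141, 92, 88, 142, 146, 20, 166, 163,
    104, 130, 131, 117, 158, 109, 133, 148, 168, 100, 123, 1, 121, 0, 36, 147, 149, 62, 76, 78, 124, 129, 128, 154, 65, 61, 153, 58, 83, 139, 30, 34, 114, 116, 42, 84, 40, 126, 86, 26]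

/-- The coordinate introduced by growth face `k` (as an index). [folklore] -/
def colOf (k : Fin 172) : Fin 172 := ⟨min (colOfFace k) 171, by omega⟩

/-- The six step-`0` coordinates: the parities of `X ∖ {2, 3}` (blocks `4, 7, 13, 25`) and `ψ_A, ψ_B`. [folklore] -/
def baseCol : Fin 6 → Fin 172 := ![2, 5, 11, 23, 170, 171]

/-- For each step-`0` coordinate, a set of internal faces whose rows sum to its unit vector (an explicit `6 × 6` inverse over `𝔽₂`). [folklore] -/
def wit : Fin 6 → Finset (Fin 172) := ![{0}, {3}, {0, 4}, {3, 5}, {0, 2, 4}, {1, 3, 5}]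

set_option maxRecDepth 100000 in set_option maxHeartbeats 4000000 in
/-- **Base**: the internal faces realise the unit vectors of the six step-`0` coordinates (counted mod `2`). [folklore] -/
theorem rows_base : ∀ c : Fin 6, ∀ j : Fin 172,
    (∑ k ∈ wit c, ((orbitRep k).filter fun x => colPred j x).card) % 2 = if j = baseCol c then 1 else 0 := by
  decide +kernel

set_option maxRecDepth 100000 in set_option maxHeartbeats 4000000 in
/-- **Triangularity of the growth rows**: growth face `k` has an odd count (one) in the coordinate `colOf k` it introduces, and an odd
count only there or in coordinates of smaller step; every coordinate is a step-`0` coordinate or is introduced by exactly the growth face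
of its step; steps are at most `166`. [folklore] -/
theorem rows_triangular : (∀ k : Fin 172, 6 ≤ k.val → ((orbitRep k).filter fun x => colPred (colOf k) x).card % 2 = 1) ∧
    (∀ k j : Fin 172, 6 ≤ k.val → ((orbitRep k).filter fun x => colPred j x).card % 2 = 1 → j = colOf k ∨ colStep j < stage k) ∧
    (∀ j : Fin 172, colStep j = 0 → ∃ c : Fin 6, baseCol c = j) ∧
    (∀ j : Fin 172, 0 < colStep j → ∃ k : Fin 172, 6 ≤ k.val ∧ colOf k = j ∧ stage k = colStep j) ∧
    (∀ j : Fin 172, colStep j ≤ 166) := by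
  refine ⟨by decide +kernel, by decide +kernel, by decide +kernel, by decide +kernel, by decide +kernel⟩

/-- Casting a count to `𝔽₂` only sees it mod `2`. [folklore] -/
theorem natCast_mod_two_eq (c : ℕ) : ((c % 2 : ℕ) : ZMod 2) = (c : ZMod 2) := ZMod.natCast_mod c 2

/-- The span of the coordinate rows of the faces. [folklore] -/
def rowSpan : Submodule (ZMod 2) (Fin 172 → ZMod 2) := Submodule.span (ZMod 2) (Set.range rowOf)

/-- **The rows span `𝔽₂^{172}`** (base: the six step-`0` coordinates from the internal faces; induction on the step for the others). [folklore] -/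
theorem unit_mem_rowSpan : ∀ n : ℕ, ∀ j : Fin 172, colStep j ≤ n → (Pi.single j (1 : ZMod 2) : Fin 172 → ZMod 2) ∈ rowSpan := by
  obtain ⟨hdiag, htri, hbase, hsurj, -⟩ := rows_triangular
  intro n
  induction n with
  | zero =>
    intro j hj
    obtain ⟨c, hc⟩ := hbase j (Nat.le_zero.mp hj)
    subst hc
    have e : (Pi.single (baseCol c) (1 : ZMod 2) : Fin 172 → ZMod 2) = ∑ k ∈ wit c, rowOf k := by
      funext j'
      rw [Finset.sum_apply]
      simp only [rowOf]
      rw [← Nat.cast_sum, ← natCast_mod_two_eq, rows_base c j']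
      by_cases h : j' = baseCol c
      · rw [h, if_pos rfl, Pi.single_eq_same, Nat.cast_one]
      · rw [Pi.single_eq_of_ne h, if_neg h, Nat.cast_zero]
    rw [e]
    exact Submodule.sum_mem _ fun k _ => Submodule.subset_span ⟨k, rfl⟩
  | succ n ih =>
    intro j hj
    rcases Nat.lt_or_ge (colStep j) (n + 1) with hlt | hge
    · exact ih j (by omega)
    · obtain ⟨k, hk6, hkj, hks⟩ := hsurj j (by omega)
      have hrow : rowOf k = ∑ j' : Fin 172, rowOf k j' • (Pi.single j' (1 : ZMod 2) : Fin 172 → ZMod 2) := pi_eq_sum_univ' (rowOf k)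
      rw [← Finset.add_sum_erase _ _ (Finset.mem_univ j)] at hrow
      have hdb : rowOf k j = 1 := by
        rw [rowOf, ← natCast_mod_two_eq, ← hkj, hdiag k hk6, Nat.cast_one]
      rw [hdb, one_smul] at hrow
      have hrest : (∑ j' ∈ univ.erase j, rowOf k j' • (Pi.single j' (1 : ZMod 2) : Fin 172 → ZMod 2)) ∈ rowSpan := by
        refine Submodule.sum_mem _ fun j' hj' => ?_
        by_cases hz : rowOf k j' = 0
        · rw [hz, zero_smul]; exact Submodule.zero_mem _
        · refine Submodule.smul_mem _ _ (ih j' ?_)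
          have hodd : ((orbitRep k).filter fun x => colPred j' x).card % 2 = 1 := by
            rw [rowOf, ← natCast_mod_two_eq] at hz
            have h2 : ((orbitRep k).filter fun x => colPred j' x).card % 2 < 2 := Nat.mod_lt _ (by norm_num)
            have h0 : ((orbitRep k).filter fun x => colPred j' x).card % 2 ≠ 0 := fun e => hz (by rw [e, Nat.cast_zero])
            omega
          rcases htri k j' hk6 hodd with h1 | h2
          · exact absurd (h1.trans hkj) (Finset.ne_of_mem_erase hj')
          · omega
      have hk_mem : rowOf k ∈ rowSpan := Submodule.subset_span ⟨k, rfl⟩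
      have e : (Pi.single j (1 : ZMod 2) : Fin 172 → ZMod 2) =
          rowOf k - ∑ j' ∈ univ.erase j, rowOf k j' • (Pi.single j' (1 : ZMod 2) : Fin 172 → ZMod 2) :=
        eq_sub_of_add_eq hrow.symm
      rw [e]
      exact Submodule.sub_mem _ hk_mem hrest

/-- The rows span everything. [folklore] -/
theorem rowSpan_eq_top : rowSpan = (⊤ : Submodule (ZMod 2) (Fin 172 → ZMod 2)) := by
  refine Submodule.eq_top_iff'.mpr fun w => ?_
  rw [pi_eq_sum_univ' w]
  refine Submodule.sum_mem _ fun j _ => Submodule.smul_mem _ _ ?_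
  exact unit_mem_rowSpan 166 j (rows_triangular.2.2.2.2 j)

/-- Hodge vectors realising the unit vectors of `𝔽₂^{172}` exist (sums of faces): `coordFun` maps `H` onto `𝔽₂^{172}`. [folklore] -/
theorem exists_hodge_coord_single (j : Fin 172) : ∃ v ∈ hodgeLattice, coordFun v = Pi.single j 1 := by
  have hmem : (Pi.single j (1 : ZMod 2) : Fin 172 → ZMod 2) ∈ rowSpan := by rw [rowSpan_eq_top]; exact Submodule.mem_top
  refine Submodule.span_induction (p := fun w _ => ∃ v ∈ hodgeLattice, coordFun v = w) ?_ ?_ ?_ ?_ hmem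
  · rintro _ ⟨k, rfl⟩
    exact ⟨atomVec k, atoms_le (atomVec_mem k), coordFun_atomVec k⟩
  · exact ⟨0, Submodule.zero_mem _, coordFun_zero⟩
  · rintro _ _ _ _ ⟨v, hv, rfl⟩ ⟨v', hv', rfl⟩
    exact ⟨v + v', Submodule.add_mem _ hv hv', coordFun_add v v'⟩
  · rintro c _ _ ⟨v, hv, rfl⟩
    refine ⟨(c.val : ℤ) • v, Submodule.smul_mem _ _ hv, ?_⟩
    rw [coordFun_smul]
    funext i
    rw [Pi.smul_apply, Pi.smul_apply, smul_eq_mul, zsmul_eq_mul, Int.cast_natCast, ZMod.natCast_zmod_val]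

/-- **MINIMALITY (`μ(Dic₆) ≥ 172`).**  If the Hodge lattice of the `Dic₆`-slice is generated, together with the divisor classes, by the
Galois translates of a finite family `S` of Hodge vectors, then `|S| ≥ 172` — TWO MORE than the block-parity floor `170` of this type
(`coordFun` is additive, kills the pairs, is translation invariant on `H` and maps `H` onto `𝔽₂^{172}`).  With the upper bound of
`Census/TwentyFourDicyclicLattice.lean`: `μ(Dic₆) = 172 = #blocks`, attained by rank-four faces. [folklore] -/
theorem le_card_of_generates_172 (S : Finset (Pt → ℤ)) (hSH : ∀ t ∈ S, t ∈ hodgeLattice)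
    (hS : hodgeLattice ≤ pairs ⊔ Submodule.span ℤ {v | ∃ g : G, ∃ t ∈ S, v = transl g t}) : 172 ≤ S.card := by
  classical
  let T : Finset (Fin 172 → ZMod 2) := S.image coordFun
  let U : Submodule (ZMod 2) (Fin 172 → ZMod 2) := Submodule.span (ZMod 2) (T : Set (Fin 172 → ZMod 2))
  let W : Submodule ℤ (Pt → ℤ) :=
    { carrier := {v | coordFun v ∈ U}
      zero_mem' := by
        show coordFun 0 ∈ U
        rw [coordFun_zero]
        exact U.zero_mem
      add_mem' := by
        intro v w hv hw
        show coordFun (v + w) ∈ U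
        rw [coordFun_add]
        exact U.add_mem hv hw
      smul_mem' := by
        intro c v hv
        show coordFun (c • v) ∈ U
        rw [coordFun_smul]
        exact zsmul_mem hv c }
  have hle : pairs ⊔ Submodule.span ℤ {v | ∃ g : G, ∃ t ∈ S, v = transl g t} ≤ W := by
    refine sup_le (Submodule.span_le.mpr ?_) (Submodule.span_le.mpr ?_)
    · rintro _ ⟨x, rfl⟩
      show coordFun (pairVec x) ∈ U
      rw [coordFun_pairVec x]
      exact U.zero_mem
    · rintro _ ⟨g, t, ht, rfl⟩
      show coordFun (transl g t) ∈ U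
      rw [show coordFun (transl g t) = coordFun t from funext fun j => coordFun_transl_hodge g (hSH t ht) j]
      exact Submodule.subset_span (by simpa [T] using Finset.mem_image_of_mem coordFun ht)
  have hunit : ∀ j : Fin 172, (Pi.single j 1 : Fin 172 → ZMod 2) ∈ U := by
    intro j
    obtain ⟨v, hv, hpv⟩ := exists_hodge_coord_single j
    have h : coordFun v ∈ U := hle (hS hv)
    rwa [hpv] at h
  have htop : U = ⊤ := by
    refine Submodule.eq_top_iff'.mpr fun w => ?_
    rw [pi_eq_sum_univ' w]
    exact Submodule.sum_mem _ fun j _ => Submodule.smul_mem _ _ (hunit j)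
  have h1 : Module.finrank (ZMod 2) U ≤ T.card := finrank_span_finset_le_card T
  rw [htop, finrank_top, Module.finrank_fin_fun] at h1
  exact h1.trans Finset.card_image_le

end Summit.HodgeConjecture.CorCM.Census.TwentyFourDicyclicSpecies
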